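import Summits.CriticalPhenomena.SAWScalingLimit.Theorems.SAWDefectDecoherenceBoundaryClosureREquivalence
import Summits.CriticalPhenomena.SAWScalingLimit.Theorems.SAWDefectDecoherenceBoundaryClosureRArrivalMonotone
import Summits.CriticalPhenomena.SAWScalingLimit.Theorems.SAWDefectDecoherenceBoundaryClosureRSqueeze
import Summits.CriticalPhenomena.SAWScalingLimit.Theorems.SAWDefectDecoherenceBoundaryClosureRGateTraceOfGateData
import Summits.CriticalPhenomena.SAWScalingLimit.Theorems.SAWDefectDecoherenceBoundaryClosureRGateStability
import Summits.CriticalPhenomena.SAWScalingLimit.Theorems.SAWDefectDecoherenceBoundaryClosureRGateDbarLimit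
import Summits.CriticalPhenomena.SAWScalingLimit.Theorems.SAWDefectDecoherenceBoundaryClosureRInnerZigzagSep
import Summits.CriticalPhenomena.SAWScalingLimit.Theorems.SAWDefectDecoherenceBoundaryClosureRZigzagDiscretisation
import Summits.CriticalPhenomena.SAWScalingLimit.Theorems.SAWDefectDecoherenceBoundaryClosureRPolygonIdentification
import HarnessLib

/-!
# The ENGINE of line `polygon-parity-squeeze` (crux `BoundaryClosureR`, stmt-CriticalPhenomena-14004):
# `BoundaryClosureR` from the three model inputs

`BoundaryClosureR` (= `DefectDecoherence → MassRatio → HexObservableLimitR`) follows from the line's three MODEL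
INPUTS — `GateL1Root` ([I] up to the flat gate), `PolygonPackage` (`L¹`/root tightness, boundary layer budgets and
ratio mixing at `b`, on EXACT POLYGON families only) and `GateCollarAvoidance` (positive-mass restriction input) —
by the landed mechanisms of the line: (A) identification on exact polygons (`stub_polygonIdentification`), (B) the
squeeze (`squeeze_of_innerPolygons` with the inner-polygon construction `stub_innerPolygonsOfZigzag ∘
stub_innerZigzagPolygonSep` and gate stability `stub_gateStability`), (C) the gate trace
(`gateTrace_of_gateDbarLimit` with `GateDbar.stub_gateDbarLimit`), domain monotonicity `stub_arrivalMonotone`, and the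
certificate `Equivalence.target_of_inputs`.  This is the Theorems-side copy of the composition `BoundaryClosureR_of`
of the skeleton `Cruxes/BoundaryClosureR/Lines/polygon_parity_squeeze.lean` with every provable stub discharged: a
CONDITIONAL closing of the crux, conditional exactly on the three model inputs (stated unfolded, as hypotheses).
-/

noncomputable section

open scoped BigOperators Topology
open Filter Set MeasureTheory Metric
open Literature.Probability.LatticeModels Literature.Probability.RandomPlanarGeometry
open Literature.Probability.RandomPlanarGeometry.SAW
open Summit.CriticalPhenomena.SAWScalingLimit.Theses.SAWDefectDecoherence

namespace Summit.CriticalPhenomena.SAWScalingLimit.Theorems.PolygonParitySqueeze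

/-- **`BoundaryClosureR` from the three model inputs of line `polygon-parity-squeeze`** (`GateL1Root`,
`PolygonPackage`, `GateCollarAvoidance`, unfolded): identification on exact polygons (A), squeeze (B) and gate
trace (C) produce `GateTraceH`; `GateL1Root` restricted to compacts of the carrier is `LocalL1Root`; the certificate
`Equivalence.target_of_inputs` closes `HexObservableLimitR`.
[cite: DuminilCopinSmirnov2012, Conjecture 2 (boundary shadow on the gate)] -/
theorem BoundaryClosureR_of_modelInputs : (∀ (D : DobrushinDomain) (ρ : ℝ) (Λ : ℝ → Finset HexVertex) (m : ℝ → ℤ) (b : ℝ → Sym2 HexVertex), AdmissibleFamily D ρ Λ m b → ∀ (a : ℝ → Sym2 HexVertex) (r₀ : ℝ) (m₀ : ℝ → ℤ), PinnedFlatRoot D Λ b (D.pt 0) a r₀ m₀ → ∀ K : Set ℂ, IsCompact K → K ⊆ D.carrier ∪ gateSeg D ρ → D.pt 0 ∉ K → L1BoundOn Λ a b K) → ((∀ (D : DobrushinDomain) (ρ : ℝ) (Λ : ℝ → Finset HexVertex) (m : ℝ → ℤ) (b : ℝ → Sym2 HexVertex), AdmissibleFamily D ρ Λ m b → ExactPolygonFamily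 D Λ → ∀ (a : ℝ → Sym2 HexVertex) (r₀ : ℝ) (m₀ : ℝ → ℤ), PinnedFlatRoot D Λ b (D.pt 0) a r₀ m₀ → (∀ K : Set ℂ, IsCompact K → K ⊆ closure D.carrier → D.pt 0 ∉ K → L1BoundOn Λ a b K) ∧ RootTightAt Λ a b (D.pt 0)) ∧ (∀ (D : DobrushinDomain) (ρ : ℝ) (Λ : ℝ → Finset HexVertex) (m : ℝ → ℤ) (b : ℝ → Sym2 HexVertex), AdmissibleFamily D ρ Λ m b → ExactPolygonFamily D Λ → ∀ (a : ℝ → Sym2 HexVertex) (r₀ : ℝ) (m₀ : ℝ → ℤ), PinnedFlatRoot D Λ b (D.pt 0) a r₀ m₀ → (∀ z ∈ frontier D.carrier, z ≠ D.pt 0 → BoundaryLayerBudgetAt Λ a b z) ∧ (2 * ρ < dist (D.pt 0) (D.pt 1) → GateLayerBudgetAt D (ρ / 2) Λ m a b)) ∧ (∀ (D : DobrushinDomain) (ρ : ℝ) (Λ : ℝ → Finset HexVertex) (m : ℝ → ℤ) (b : ℝ → Sym2 HexVertex), AdmissibleFamily D ρ Λ m b → ExactPolygonFamily D Λ → ∀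 (a : ℝ → Sym2 HexVertex) (r₀ : ℝ) (m₀ : ℝ → ℤ), PinnedFlatRoot D Λ b (D.pt 0) a r₀ m₀ → RatioMixingAt Λ a b)) → (∀ (D : DobrushinDomain) (ρ : ℝ) (Λ : ℝ → Finset HexVertex) (m : ℝ → ℤ) (b : ℝ → Sym2 HexVertex), AdmissibleFamily D ρ Λ m b → ∀ (a : ℝ → Sym2 HexVertex) (r₀ : ℝ) (m₀ : ℝ → ℤ), PinnedFlatRoot D Λ b (D.pt 0) a r₀ m₀ → CollarAvoidanceAt D ρ Λ a r₀) → Summit.CriticalPhenomena.SAWScalingLimit.Theses.SAWDefectDecoherence.BoundaryClosureR := by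
  intro h1 h2 h4 hDD hMR
  -- [I] on compacts of the carrier from `GateL1Root`
  have hroot : ∀ {D : DobrushinDomain} {Λ : ℝ → Finset HexVertex} {b : ℝ → Sym2 HexVertex} {x : ℂ}
      {e : ℝ → Sym2 HexVertex} {r : ℝ} {mr : ℝ → ℤ}, PinnedFlatRoot D Λ b x e r mr → x ∉ D.carrier := by
    intro D Λ b x e r mr hPR hx
    have hmem : x ∈ D.carrier ∩ Metric.ball x r := ⟨hx, Metric.mem_ball_self hPR.1⟩
    rw [hPR.2.1] at hmem
    have h2 : x.im < x.im := hmem.1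
    exact lt_irrefl _ h2
  have hL1 : ∀ (D : DobrushinDomain) (ρ : ℝ) (Λ : ℝ → Finset HexVertex) (m : ℝ → ℤ) (b : ℝ → Sym2 HexVertex),
      AdmissibleFamily D ρ Λ m b → ∀ (a : ℝ → Sym2 HexVertex) (r₀ : ℝ) (m₀ : ℝ → ℤ),
      PinnedFlatRoot D Λ b (D.pt 0) a r₀ m₀ → ∀ K : Set ℂ, IsCompact K → K ⊆ D.carrier → L1BoundOn Λ a b K :=
    fun D ρ Λ m b hAF a r₀ m₀ hPR K hK hKD =>
      h1 D ρ Λ m b hAF a r₀ m₀ hPR K hK (hKD.trans Set.subset_union_left) (fun hx => hroot hPR (hKD hx))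
  -- (A) the gate profile law on exact polygons
  have h3 := stub_polygonIdentification h2 hDD hMR
  -- (B) the squeeze: gate data for every admissible family
  have h5 := squeeze_of_innerPolygons (stub_innerPolygonsOfZigzag stub_innerZigzagPolygonSep) stub_gateStability
    stub_arrivalMonotone h3 h2 h4
  -- (C) the gate trace, then the certificate
  have h6 := gateTrace_of_gateDbarLimit GateDbar.stub_gateDbarLimit h5 h1 hDD hMR
  exact Summit.CriticalPhenomena.SAWScalingLimit.Theorems.PickHalfPlane.Equivalence.target_of_inputs hDD hMR hL1 h6

/-- **`BoundaryClosureR` from the three model inputs, each only under the route hypotheses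
`DefectDecoherence ∧ MassRatio`** — the genuinely weaker form in which the inputs should be promoted: the
engine only ever consumes them after `DefectDecoherence`, `MassRatio` are assumed.
[cite: DuminilCopinSmirnov2012, Conjecture 2 (boundary shadow on the gate)] -/
theorem BoundaryClosureR_of_conditionalInputs : (DefectDecoherence → MassRatio → ∀ (D : DobrushinDomain) (ρ : ℝ) (Λ : ℝ → Finset HexVertex) (m : ℝ → ℤ) (b : ℝ → Sym2 HexVertex), AdmissibleFamily D ρ Λ m b → ∀ (a : ℝ → Sym2 HexVertex) (r₀ : ℝ) (m₀ : ℝ → ℤ), PinnedFlatRoot D Λ b (D.pt 0) a r₀ m₀ → ∀ K : Set ℂ, IsCompact K → K ⊆ D.carrier ∪ gateSeg D ρ → D.pt 0 ∉ K → L1BoundOn Λ a b K) → (DefectDecoherence → MassRatio → (∀ (D : DobrushinDomain) (ρ : ℝ) (Λ : ℝ → Finset HexVertex) (m : ℝ → ℤ) (b : ℝ → Sym2 HexVertex), AdmissibleFamily D ρ Λ m b → ExactPolygonFamily D Λ → ∀ (a : ℝ → Sym2 HexVertex) (r₀ : ℝ) (m₀ : ℝ → ℤ), PinnedFlatRoot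 D Λ b (D.pt 0) a r₀ m₀ → (∀ K : Set ℂ, IsCompact K → K ⊆ closure D.carrier → D.pt 0 ∉ K → L1BoundOn Λ a b K) ∧ RootTightAt Λ a b (D.pt 0)) ∧ (∀ (D : DobrushinDomain) (ρ : ℝ) (Λ : ℝ → Finset HexVertex) (m : ℝ → ℤ) (b : ℝ → Sym2 HexVertex), AdmissibleFamily D ρ Λ m b → ExactPolygonFamily D Λ → ∀ (a : ℝ → Sym2 HexVertex) (r₀ : ℝ) (m₀ : ℝ → ℤ), PinnedFlatRoot D Λ b (D.pt 0) a r₀ m₀ → (∀ z ∈ frontier D.carrier, z ≠ D.pt 0 → BoundaryLayerBudgetAt Λ a b z) ∧ (2 * ρ < dist (D.pt 0) (D.pt 1) → GateLayerBudgetAt D (ρ / 2) Λ m a b)) ∧ (∀ (D : DobrushinDomain) (ρ : ℝ) (Λ : ℝ → Finset HexVertex) (m : ℝ → ℤ) (b : ℝ → Sym2 HexVertex), AdmissibleFamily D ρ Λ m b → ExactPolygonFamily D Λ → ∀ (a : ℝ → Sym2 HexVertex) (r₀ : ℝ) (m₀ : ℝ → ℤ), PinnedFlatRoot D Λ b (D.pt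 0) a r₀ m₀ → RatioMixingAt Λ a b)) → (DefectDecoherence → MassRatio → ∀ (D : DobrushinDomain) (ρ : ℝ) (Λ : ℝ → Finset HexVertex) (m : ℝ → ℤ) (b : ℝ → Sym2 HexVertex), AdmissibleFamily D ρ Λ m b → ∀ (a : ℝ → Sym2 HexVertex) (r₀ : ℝ) (m₀ : ℝ → ℤ), PinnedFlatRoot D Λ b (D.pt 0) a r₀ m₀ → CollarAvoidanceAt D ρ Λ a r₀) → Summit.CriticalPhenomena.SAWScalingLimit.Theses.SAWDefectDecoherence.BoundaryClosureR :=
  fun h1 h2 h4 hDD hMR => BoundaryClosureR_of_modelInputs (h1 hDD hMR) (h2 hDD hMR) (h4 hDD hMR) hDD hMR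

end Summit.CriticalPhenomena.SAWScalingLimit.Theorems.PolygonParitySqueeze

end
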